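import Literature.MathematicalPhysics.QuantumFieldTheory.BalabanImbrieJaffe1984to88.BIJ88TrainPieces306

/-!
# `BalabanImbrieJaffe1984to88.BIJ88WalkKernelDecay307` — T. Bałaban, J. Imbrie, A. Jaffe, *Effective action and cluster properties of the
abelian Higgs model*, Commun. Math. Phys. **114** (1988) 257–315 [BalabanImbrieJaffe1988]: pp. 306–307 [PDF 50–51] (Sect. 5.13) — **THE
SIZE OF THE WALK KERNEL `C𝔫(c)`: EVERY BOUNDARY CROSSED COSTS `O(1)`, EVERY STRETCH BETWEEN BOUNDARIES COSTS THE DECAY OF `C_s`**.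
Print, p. 306: *"The sum over pairings and the sum over ways of arranging the contractions combine into a sum over walks"*; p. 305: *"an
exponentially decaying covariance C_s"*; p. 307: *"Functional derivatives hitting χ′-factors within ½r(e_k) of Λ₁₀^{(k)c} are connected through
C_ω(α) to Λ₁₁^{(k)}, so we get small factors e^{−cr(e_k)} from the exponential decay of the operators C_s and Δ in C_ω(α). … If the walk ω(α)
wanders through more than a few cubes, we begin to pick up factors e^{−cr(e_k)}. These control the sum over walks and partitions, and the
factorials, as in [9]."* ([9] = Glimm–Jaffe–Spencer, Erice 1973).

In the tree the kernel of one train of the located (5.13.3) (`BIJ88WalkFormLocated309`, `BIJ88TrainsDsetExpansion306.trains_apply_eq_sum_dset`)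
is `C * wker C N c` with p13's WALK KERNEL `BIJ88TrainPieces306.wker`: `𝔫(∅) = 1`, `𝔫(c) = Σ_{b∈c} N_b C 𝔫(c∖b)` — the sum over the orderings
`(b₁,…,b_k)` of `c` of `N_{b₁} C N_{b₂} C ⋯ N_{b_k} C`.  THIS FILE bounds its entries from three letters — `|C(y,x)| ≤ a e^{−δρ(y,x)}` (decay of
`C_s`, `BIJ88CsDecay305.csDecay`), `Σ_x e^{−(δ/2)ρ(y,x)} ≤ Z` (lattice sums), and for each boundary term `N_b`: entries supported on `U_b × U′_b` with
row sums `≤ m` (p. 306 *"The form Δ has a range less than ½r(e_k)"*) — in CERTIFICATE FORM: the reader supplies GAUGES `E b b′ ≥ e^{−(δ/2)ρ(x′,x)}`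
(`x′ ∈ U′_b`, `x ∈ U_{b′}`: the stretch from boundary `b` to boundary `b′`), `Eout b ≥ e^{−(δ/2)ρ(x′,q)}` (last stretch), `Ein b′ ≥ e^{−(δ/2)ρ(p,x)}`
(first stretch) and any SUPERSOLUTION `W` of the walk recursion

  `Eout b ≤ W b ∅`,  `Σ_{b′∈c} E b b′ · W b′ (c∖b′) ≤ W b c`  (`c ≠ ∅`),

and gets **`|(C𝔫(c))(x′,q)| ≤ a (aZm)^{|c|} W b c`** for `x′ ∈ U′_b` (`abs_C_mul_wker_apply_le`) and **`|(C𝔫(c))(p,q)| ≤ a (aZm)^{|c|} Σ_{b′∈c}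
Ein b′ W b′ (c∖b′)`** (`abs_C_mul_wker_apply_le_entry`).  The least supersolution is the sum over the orderings of `c` of the products of the
gauges along the walk — print's sum over walks with its decay factors; the constant supersolution `W b c = |c|!` (all gauges `≤ 1`) is print's
*"factorials"* (`abs_C_mul_wker_apply_le_factorial`); a closed form `W` that EATS the factorial with the decay is the combinatorial step *"as in
[9]"*, left to the estimate that consumes this file.  No pseudo-metric axiom is used beyond `ρ ≥ 0`: all geometry sits in the gauges.

statement-level skeleton of published theorems with citation tags; proofs where landed; nothing here is a claim about the Yang–Mills mass gap

PDF held: `paper:balaban1988-cmp114-bij-abelian-higgs-effective-action` (journal page = PDF page + 256); pages re-read this session as text: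
PDF 50 (p. 306), PDF 51 (p. 307) L4–18, PDF 59 (p. 315, reference [9]).

CITATION HEADER (lean-in-tree rule).  Part of the lit-balaban TYPED SKELETON (HOME `run/shared/lean/pub/lit-balaban/`), Phase 2, seat p36
(gen 21, unit `lit-balaban-p36`); rows **C2.Eq5.14.3-5.14.4** (member: §f estimate E2 — the decay currency of the trains, which pays the
`θ^{β′}` of the far cubes of `X″` in `h5144three` and controls `Σ_P` and the walk sums) and C2.Eq5.13.3-5.13.4 (member: size of p13's `wker`) of
`HOME/lit-balaban-r16/ROWS-C2-part2.md` (owner r16, referee ref-5).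
WHAT IS REPRODUCED (theorem-only; no definitions, no `Prop` facts; axioms standard):
* §1 `abs_mul_mul_apply_le` — ONE STRETCH AND ONE BOUNDARY: `|(X N M)(y,q)| ≤ a Z m e B` from row decay of `X`, support/row sums of `N`, a
  gauge `e` for the stretch `y → U` and a bound `B` of the continuation `M(·,q)` on `U′`.
* §2 `abs_C_mul_wker_apply_le_of_forall_erase` (entering `𝔫(c)`, `c ≠ ∅`, given bounds for every `𝔫(c∖b′)`), **`abs_C_mul_wker_apply_le`** (the
  supersolution bound, strong induction on `c` along `wker_eq`/`wker_empty`), **`abs_C_mul_wker_apply_le_entry`** (first stretch from any site).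
* §3 `abs_C_mul_wker_singleton_apply_le` (`|(C N_b C)(p,q)| ≤ a²Zm·Ein·Eout`), `abs_C_mul_wker_apply_le_factorial` (gauges `≤ 1`: the
  supersolution `|c|!`, `≤ a (aZm)^{|c|} |c|!`), **`abs_C_mul_wker_apply_le_geometric`** / `…_geometric_entry` (summable gauges
  `Σ_{b′∈c} E b b′ ≤ K`: the supersolution `K^{|c|}`, `≤ a (aZmK)^{|c|}` — the decay pays the factorial); §1 also has `exp_gauge_of_le`
  (gauges from any lower bound of the distances between supports).
HONEST SCOPE.  Entrywise sizes of the tree's `C * wker C N c` only; the identification of the least supersolution with the sum over orderings,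
the lattice-sum letter `Z`, the decay letter of `C_s` and the closed-form supersolution of [9] are inputs/successors, not derived here.

REVISION (doc-only, referee/owner items N-ref1-g107-2 / D-owner-v2.389): the p. 307 L11–13 quotation above now carries print's region symbols
`Λ₁₀^{(k)c}` / `Λ₁₁^{(k)}` and *"χ′-factors"*; no declaration changed.
-/

namespace Literature.MathematicalPhysics.QuantumFieldTheory.BalabanImbrieJaffe1984to88.BIJ88WalkKernelDecay307

open Finset Matrix
open scoped BigOperators
open BIJ88TrainPieces306 (wker wker_empty wker_eq)

variable {α : Type} [Fintype α]

/-! ## §1  One stretch of `C` and one boundary term -/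

/-- **ONE STRETCH AND ONE BOUNDARY.**  Rows of `X` decay (`|X(y,x)| ≤ a e^{−δρ(y,x)}`, lattice sums `Σ_x e^{−(δ/2)ρ(y,x)} ≤ Z`), the boundary
term `N` is supported on `U × U′` with row sums `≤ m`, the continuation `M(·,q)` is `≤ B` on `U′`, and `e` gauges the stretch from `y` to `U`
(`e^{−(δ/2)ρ(y,x)} ≤ e` on `U`): then `|(X N M)(y,q)| ≤ a·Z·m·e·B` — half the decay rate pays the sum over the entrance site, the other half
is the gauge (p. 307 *"we begin to pick up factors e^{−cr(e_k)}"*). [cite: BalabanImbrieJaffe1988, §5.13 p.306–307] -/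
theorem abs_mul_mul_apply_le {X N M : Matrix α α ℝ} {ρ : α → α → ℝ} {a δ Z m e B : ℝ} {U U' : Set α}
    (hX : ∀ y x, |X y x| ≤ a * Real.exp (-(δ * ρ y x))) (hZ : ∀ y, ∑ x, Real.exp (-(δ / 2 * ρ y x)) ≤ Z)
    (hsupp : ∀ x x', N x x' ≠ 0 → x ∈ U ∧ x' ∈ U') (hrow : ∀ x, ∑ x', |N x x'| ≤ m) (he : 0 ≤ e) (hB : 0 ≤ B) (y q : α)
    (heU : ∀ x ∈ U, Real.exp (-(δ / 2 * ρ y x)) ≤ e) (hM : ∀ x' ∈ U', |M x' q| ≤ B) :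
    |(X * N * M) y q| ≤ a * Z * m * e * B := by
  have hm : 0 ≤ m := (sum_nonneg fun _ _ => abs_nonneg _).trans (hrow y)
  have ha : 0 ≤ a := by
    by_contra h
    have h' : a * Real.exp (-(δ * ρ y q)) < 0 := mul_neg_of_neg_of_pos (lt_of_not_ge h) (Real.exp_pos _)
    linarith [abs_nonneg (X y q), hX y q]
  have hNM : ∀ x, |(N * M) x q| ≤ m * B := fun x => by
    rw [Matrix.mul_apply]
    refine (abs_sum_le_sum_abs _ _).trans ?_
    calc ∑ x', |N x x' * M x' q| ≤ ∑ x', |N x x'| * B := sum_le_sum fun x' _ => by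
            rw [abs_mul]
            by_cases h : N x x' = 0
            · rw [h, abs_zero, zero_mul, zero_mul]
            · exact mul_le_mul_of_nonneg_left (hM x' (hsupp x x' h).2) (abs_nonneg _)
      _ = (∑ x', |N x x'|) * B := (sum_mul _ _ _).symm
      _ ≤ m * B := mul_le_mul_of_nonneg_right (hrow x) hB
  have hNM0 : ∀ x, x ∉ U → (N * M) x q = 0 := fun x hx => by
    rw [Matrix.mul_apply]
    refine sum_eq_zero fun x' _ => ?_
    have h0 : N x x' = 0 := by
      by_contra h
      exact hx (hsupp x x' h).1
    rw [h0, zero_mul]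
  have key : ∀ x, |X y x * (N * M) x q| ≤ a * Real.exp (-(δ / 2 * ρ y x)) * (m * e * B) := fun x => by
    by_cases hx : x ∈ U
    · rw [abs_mul]
      have h1 : |X y x| ≤ a * Real.exp (-(δ / 2 * ρ y x)) * e := by
        refine (hX y x).trans ?_
        have h2 : Real.exp (-(δ * ρ y x)) = Real.exp (-(δ / 2 * ρ y x)) * Real.exp (-(δ / 2 * ρ y x)) := by
          rw [← Real.exp_add]; congr 1; ring
        rw [h2, ← mul_assoc]
        exact mul_le_mul_of_nonneg_left (heU x hx) (by positivity)
      calc |X y x| * |(N * M) x q| ≤ (a * Real.exp (-(δ / 2 * ρ y x)) * e) * (m * B) :=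
            mul_le_mul h1 (hNM x) (abs_nonneg _) (by positivity)
        _ = _ := by ring
    · rw [hNM0 x hx, mul_zero, abs_zero]; positivity
  rw [Matrix.mul_assoc, Matrix.mul_apply]
  refine (abs_sum_le_sum_abs _ _).trans ((sum_le_sum fun x _ => key x).trans ?_)
  rw [← sum_mul, ← mul_sum]
  calc a * (∑ x, Real.exp (-(δ / 2 * ρ y x))) * (m * e * B) ≤ a * Z * (m * e * B) := by gcongr; exact hZ y
    _ = a * Z * m * e * B := by ring

omit [Fintype α] in
/-- gauges from distances: if `d ≤ ρ(x′,x)` on `P × Q` and `0 ≤ δ` then `e^{−(δ/2)d}` gauges every stretch from `P` to `Q` (how the reader turns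
the geometry of the supports — cubes `r(e_k)` apart — into the gauges below). [cite: BalabanImbrieJaffe1988, §5.13 p.307] -/
theorem exp_gauge_of_le {ρ : α → α → ℝ} {δ d : ℝ} (hδ : 0 ≤ δ) {P Q : Set α} (hd : ∀ x' ∈ P, ∀ x ∈ Q, d ≤ ρ x' x) :
    ∀ x' ∈ P, ∀ x ∈ Q, Real.exp (-(δ / 2 * ρ x' x)) ≤ Real.exp (-(δ / 2 * d)) := fun x' hx' x hx =>
  Real.exp_le_exp.2 (by nlinarith [hd x' hx' x hx])

/-! ## §2  The walk kernel `C𝔫(c)`: supersolutions of the walk recursion bound it -/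

variable [DecidableEq α] {I : Type} [DecidableEq I]

/-- **ENTERING `𝔫(c)`** (`c ≠ ∅`) from a site `y`: if every continuation `C𝔫(c∖b′)(·,q)` is `≤ B b′` on the exit set `U′_{b′}` and `e b′`
gauges the stretch from `y` to `U_{b′}`, then `|(C𝔫(c))(y,q)| ≤ aZm · Σ_{b′∈c} e b′ · B b′` — the recursion `𝔫(c) = Σ_{b′∈c} N_{b′} C 𝔫(c∖b′)`
(`BIJ88TrainPieces306.wker_eq`) estimated term by term with §1. [cite: BalabanImbrieJaffe1988, §5.13 p.306–307] -/
theorem abs_C_mul_wker_apply_le_of_forall_erase {C : Matrix α α ℝ} {N : Finset I → Matrix α α ℝ} {ρ : α → α → ℝ} {a δ Z m : ℝ}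
    {U U' : Finset I → Set α} (hC : ∀ y x, |C y x| ≤ a * Real.exp (-(δ * ρ y x)))
    (hZ : ∀ y, ∑ x, Real.exp (-(δ / 2 * ρ y x)) ≤ Z) (hsupp : ∀ b x x', N b x x' ≠ 0 → x ∈ U b ∧ x' ∈ U' b)
    (hrow : ∀ b x, ∑ x', |N b x x'| ≤ m) (q y : α) {c : Finset (Finset I)} (hc : c.Nonempty) {e B : Finset I → ℝ}
    (he0 : ∀ b' ∈ c, 0 ≤ e b') (he : ∀ b' ∈ c, ∀ x ∈ U b', Real.exp (-(δ / 2 * ρ y x)) ≤ e b') (hB0 : ∀ b' ∈ c, 0 ≤ B b')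
    (hB : ∀ b' ∈ c, ∀ x' ∈ U' b', |(C * wker C N (c.erase b')) x' q| ≤ B b') :
    |(C * wker C N c) y q| ≤ a * Z * m * ∑ b' ∈ c, e b' * B b' := by
  have hL : (C * wker C N c) y q = ∑ b' ∈ c, (C * N b' * (C * wker C N (c.erase b'))) y q := by
    rw [wker_eq C N hc, Finset.mul_sum, Matrix.sum_apply]
    exact sum_congr rfl fun b' _ => by simp only [Matrix.mul_assoc]
  rw [hL, Finset.mul_sum]
  refine (abs_sum_le_sum_abs _ _).trans (sum_le_sum fun b' hb' => ?_)
  calc _ ≤ a * Z * m * e b' * B b' :=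
        abs_mul_mul_apply_le hC hZ (hsupp b') (hrow b') (he0 b' hb') (hB0 b' hb') y q (he b' hb') (hB b' hb')
    _ = _ := by ring

/-- **THE SIZE OF THE WALK KERNEL (supersolution form).**  Letters: `|C(y,x)| ≤ a e^{−δρ(y,x)}` (`δ ≥ 0`, `ρ ≥ 0`), `Σ_x e^{−(δ/2)ρ(y,x)} ≤ Z`,
boundary terms `N_b` supported on `U_b × U′_b` with row sums `≤ m`; gauges `E b b′ ≥ e^{−(δ/2)ρ(x′,x)}` for `x′ ∈ U′_b`, `x ∈ U_{b′}` and
`Eout b ≥ e^{−(δ/2)ρ(x′,q)}` for `x′ ∈ U′_b`; `W ≥ 0` a supersolution of the walk recursion, `Eout b ≤ W b ∅` and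
`Σ_{b′∈c} E b b′ · W b′ (c∖b′) ≤ W b c` for `c ≠ ∅`.  Then for every `c`, every boundary `b` and every exit site `x′ ∈ U′_b`:
`|(C𝔫(c))(x′,q)| ≤ a · (aZm)^{|c|} · W b c` — each of the `|c|` boundaries crossed costs `aZm`, the stretches cost what the gauges say, summed
over the orders in which the walk takes the boundaries (p. 307: the decay of `C_s` *"control[s] the sum over walks and partitions, and the
factorials"*). [cite: BalabanImbrieJaffe1988, §5.13 p.306–307] -/
theorem abs_C_mul_wker_apply_le {C : Matrix α α ℝ} {N : Finset I → Matrix α α ℝ} {ρ : α → α → ℝ} {a δ Z m : ℝ}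
    {U U' : Finset I → Set α} (hρ : ∀ y x, 0 ≤ ρ y x) (hδ : 0 ≤ δ) (hC : ∀ y x, |C y x| ≤ a * Real.exp (-(δ * ρ y x)))
    (hZ : ∀ y, ∑ x, Real.exp (-(δ / 2 * ρ y x)) ≤ Z) (hsupp : ∀ b x x', N b x x' ≠ 0 → x ∈ U b ∧ x' ∈ U' b)
    (hrow : ∀ b x, ∑ x', |N b x x'| ≤ m) (q : α) {E : Finset I → Finset I → ℝ} {Eout : Finset I → ℝ}
    (hE0 : ∀ b b', 0 ≤ E b b') (hE : ∀ b b', ∀ x' ∈ U' b, ∀ x ∈ U b', Real.exp (-(δ / 2 * ρ x' x)) ≤ E b b')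
    (hEout : ∀ b, ∀ x' ∈ U' b, Real.exp (-(δ / 2 * ρ x' q)) ≤ Eout b) {W : Finset I → Finset (Finset I) → ℝ}
    (hW0 : ∀ b c, 0 ≤ W b c) (hWe : ∀ b, Eout b ≤ W b ∅) (hWs : ∀ b c, c.Nonempty → ∑ b' ∈ c, E b b' * W b' (c.erase b') ≤ W b c)
    (c : Finset (Finset I)) : ∀ (b : Finset I), ∀ x' ∈ U' b, |(C * wker C N c) x' q| ≤ a * (a * Z * m) ^ c.card * W b c := by
  induction c using Finset.strongInduction with
  | H c ih =>
    intro b x' hx'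
    have ha : 0 ≤ a := by
      by_contra h
      have h' : a * Real.exp (-(δ * ρ x' q)) < 0 := mul_neg_of_neg_of_pos (lt_of_not_ge h) (Real.exp_pos _)
      linarith [abs_nonneg (C x' q), hC x' q]
    have hZ0 : 0 ≤ Z := (sum_nonneg fun _ _ => (Real.exp_pos _).le).trans (hZ x')
    have hm : 0 ≤ m := (sum_nonneg fun _ _ => abs_nonneg _).trans (hrow b x')
    rcases c.eq_empty_or_nonempty with rfl | hc
    · rw [wker_empty, Matrix.mul_one, card_empty, pow_zero, mul_one]
      have h1 : Real.exp (-(δ * ρ x' q)) ≤ Real.exp (-(δ / 2 * ρ x' q)) :=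
        Real.exp_le_exp.2 (by linarith [mul_nonneg hδ (hρ x' q)])
      calc |C x' q| ≤ a * Real.exp (-(δ * ρ x' q)) := hC x' q
        _ ≤ a * W b ∅ := mul_le_mul_of_nonneg_left ((h1.trans (hEout b x' hx')).trans (hWe b)) ha
    · obtain ⟨k, hk⟩ := Nat.exists_eq_add_one_of_ne_zero (card_ne_zero.2 hc)
      have hB : ∀ b' ∈ c, ∀ x'' ∈ U' b', |(C * wker C N (c.erase b')) x'' q| ≤ a * (a * Z * m) ^ k * W b' (c.erase b') := by
        intro b' hb' x'' hx''
        have h := ih (c.erase b') (erase_ssubset hb') b' x'' hx''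
        rwa [card_erase_of_mem hb', hk, Nat.add_sub_cancel] at h
      refine (abs_C_mul_wker_apply_le_of_forall_erase hC hZ hsupp hrow q x' hc (fun b' _ => hE0 b b')
        (fun b' _ x hx => hE b b' x' hx' x hx) (fun b' _ => mul_nonneg (mul_nonneg ha (pow_nonneg (by positivity) k)) (hW0 _ _))
        hB).trans ?_
      calc a * Z * m * ∑ b' ∈ c, E b b' * (a * (a * Z * m) ^ k * W b' (c.erase b'))
          = a * (a * Z * m) ^ c.card * ∑ b' ∈ c, E b b' * W b' (c.erase b') := by
            rw [hk, pow_succ, Finset.mul_sum, Finset.mul_sum]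
            exact sum_congr rfl fun b' _ => by ring
        _ ≤ a * (a * Z * m) ^ c.card * W b c := mul_le_mul_of_nonneg_left (hWs b c hc) (by positivity)

/-- **THE FIRST STRETCH.**  From any site `p` (a source site of `ℱ`, or a leg on the smooth factor) into `𝔫(c)`, `c ≠ ∅`: with entrance gauges
`Ein b′ ≥ e^{−(δ/2)ρ(p,x)}` on `U_{b′}`, `|(C𝔫(c))(p,q)| ≤ a · (aZm)^{|c|} · Σ_{b′∈c} Ein b′ · W b′ (c∖b′)` (same letters and supersolution
as `abs_C_mul_wker_apply_le`; for `c = ∅` the kernel is `C` itself, bounded by its letter). [cite: BalabanImbrieJaffe1988, §5.13 p.306–307] -/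
theorem abs_C_mul_wker_apply_le_entry {C : Matrix α α ℝ} {N : Finset I → Matrix α α ℝ} {ρ : α → α → ℝ} {a δ Z m : ℝ}
    {U U' : Finset I → Set α} (hρ : ∀ y x, 0 ≤ ρ y x) (hδ : 0 ≤ δ) (hC : ∀ y x, |C y x| ≤ a * Real.exp (-(δ * ρ y x)))
    (hZ : ∀ y, ∑ x, Real.exp (-(δ / 2 * ρ y x)) ≤ Z) (hsupp : ∀ b x x', N b x x' ≠ 0 → x ∈ U b ∧ x' ∈ U' b)
    (hrow : ∀ b x, ∑ x', |N b x x'| ≤ m) (q : α) {E : Finset I → Finset I → ℝ} {Eout : Finset I → ℝ}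
    (hE0 : ∀ b b', 0 ≤ E b b') (hE : ∀ b b', ∀ x' ∈ U' b, ∀ x ∈ U b', Real.exp (-(δ / 2 * ρ x' x)) ≤ E b b')
    (hEout : ∀ b, ∀ x' ∈ U' b, Real.exp (-(δ / 2 * ρ x' q)) ≤ Eout b) {W : Finset I → Finset (Finset I) → ℝ}
    (hW0 : ∀ b c, 0 ≤ W b c) (hWe : ∀ b, Eout b ≤ W b ∅) (hWs : ∀ b c, c.Nonempty → ∑ b' ∈ c, E b b' * W b' (c.erase b') ≤ W b c)
    (p : α) {Ein : Finset I → ℝ} (hEin0 : ∀ b', 0 ≤ Ein b') (hEin : ∀ b', ∀ x ∈ U b', Real.exp (-(δ / 2 * ρ p x)) ≤ Ein b')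
    {c : Finset (Finset I)} (hc : c.Nonempty) :
    |(C * wker C N c) p q| ≤ a * (a * Z * m) ^ c.card * ∑ b' ∈ c, Ein b' * W b' (c.erase b') := by
  have ha : 0 ≤ a := by
    by_contra h
    have h' : a * Real.exp (-(δ * ρ p q)) < 0 := mul_neg_of_neg_of_pos (lt_of_not_ge h) (Real.exp_pos _)
    linarith [abs_nonneg (C p q), hC p q]
  have hZ0 : 0 ≤ Z := (sum_nonneg fun _ _ => (Real.exp_pos _).le).trans (hZ p)
  obtain ⟨b₀, hb₀⟩ := hc
  have hm : 0 ≤ m := (sum_nonneg fun _ _ => abs_nonneg _).trans (hrow b₀ p)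
  have hc : c.Nonempty := ⟨b₀, hb₀⟩
  obtain ⟨k, hk⟩ := Nat.exists_eq_add_one_of_ne_zero (card_ne_zero.2 hc)
  have hB : ∀ b' ∈ c, ∀ x'' ∈ U' b', |(C * wker C N (c.erase b')) x'' q| ≤ a * (a * Z * m) ^ k * W b' (c.erase b') := by
    intro b' hb' x'' hx''
    have h := abs_C_mul_wker_apply_le hρ hδ hC hZ hsupp hrow q hE0 hE hEout hW0 hWe hWs (c.erase b') b' x'' hx''
    rwa [card_erase_of_mem hb', hk, Nat.add_sub_cancel] at h
  refine (abs_C_mul_wker_apply_le_of_forall_erase hC hZ hsupp hrow q p hc (fun b' _ => hEin0 b') (fun b' _ x hx => hEin b' x hx)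
    (fun b' _ => mul_nonneg (mul_nonneg ha (pow_nonneg (by positivity) k)) (hW0 _ _)) hB).trans (le_of_eq ?_)
  rw [hk, pow_succ, Finset.mul_sum, Finset.mul_sum]
  exact sum_congr rfl fun b' _ => by ring

/-! ## §3  Instances: one boundary; the factorial supersolution -/

/-- **ONE BOUNDARY**: `|(C𝔫({b}))(p,q)| = |(C N_b C)(p,q)| ≤ a²Zm · Ein · Eout` — the first stretch gauged by `Ein ≥ e^{−(δ/2)ρ(p,x)}` on `U_b`,
the last by `Eout ≥ e^{−(δ/2)ρ(x′,q)}` on `U′_b` (p. 307: a derivative *"connected through C_ω(α) to Λ^{(k)}"* picks up the decay of both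
stretches; with `exp_gauge_of_le`, `Ein·Eout = e^{−(δ/2)(d(p,U_b) + d(U′_b,q))}`). [cite: BalabanImbrieJaffe1988, §5.13 p.307] -/
theorem abs_C_mul_wker_singleton_apply_le {C : Matrix α α ℝ} {N : Finset I → Matrix α α ℝ} {ρ : α → α → ℝ} {a δ Z m : ℝ}
    {U U' : Finset I → Set α} (hρ : ∀ y x, 0 ≤ ρ y x) (hδ : 0 ≤ δ) (hC : ∀ y x, |C y x| ≤ a * Real.exp (-(δ * ρ y x)))
    (hZ : ∀ y, ∑ x, Real.exp (-(δ / 2 * ρ y x)) ≤ Z) (hsupp : ∀ b x x', N b x x' ≠ 0 → x ∈ U b ∧ x' ∈ U' b)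
    (hrow : ∀ b x, ∑ x', |N b x x'| ≤ m) (p q : α) (b : Finset I) {Ein Eout : ℝ} (hEin0 : 0 ≤ Ein) (hEout0 : 0 ≤ Eout)
    (hEin : ∀ x ∈ U b, Real.exp (-(δ / 2 * ρ p x)) ≤ Ein) (hEout : ∀ x' ∈ U' b, Real.exp (-(δ / 2 * ρ x' q)) ≤ Eout) :
    |(C * wker C N {b}) p q| ≤ a * (a * Z * m) * (Ein * Eout) := by
  have ha : 0 ≤ a := by
    by_contra h
    have h' : a * Real.exp (-(δ * ρ p q)) < 0 := mul_neg_of_neg_of_pos (lt_of_not_ge h) (Real.exp_pos _)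
    linarith [abs_nonneg (C p q), hC p q]
  have h1 : C * wker C N {b} = C * N b * C := by
    rw [wker_eq C N (singleton_nonempty b), sum_singleton, erase_singleton, wker_empty, Matrix.mul_one, Matrix.mul_assoc]
  have hM : ∀ x' ∈ U' b, |C x' q| ≤ a * Eout := fun x' hx' => by
    have h2 : Real.exp (-(δ * ρ x' q)) ≤ Real.exp (-(δ / 2 * ρ x' q)) :=
      Real.exp_le_exp.2 (by linarith [mul_nonneg hδ (hρ x' q)])
    exact (hC x' q).trans (mul_le_mul_of_nonneg_left (h2.trans (hEout x' hx')) ha)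
  rw [h1]
  calc |(C * N b * C) p q| ≤ a * Z * m * Ein * (a * Eout) :=
        abs_mul_mul_apply_le hC hZ (hsupp b) (hrow b) hEin0 (mul_nonneg ha hEout0) p q hEin hM
    _ = _ := by ring

/-- **THE FACTORIALS.**  With every gauge `≤ 1` — no decay used, only `δ ≥ 0`, `ρ ≥ 0` — the constant supersolution `W b c = |c|!` (the
number of orderings of `c`: `Σ_{b′∈c} (|c|−1)! = |c|!`) gives `|(C𝔫(c))(p,q)| ≤ a · (aZm)^{|c|} · |c|!` from every site: the size of the
walk kernel WITHOUT its decay, print's *"factorials"* which the decay must then control *"as in [9]"*.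
[cite: BalabanImbrieJaffe1988, §5.13 p.307] -/
theorem abs_C_mul_wker_apply_le_factorial {C : Matrix α α ℝ} {N : Finset I → Matrix α α ℝ} {ρ : α → α → ℝ} {a δ Z m : ℝ}
    {U U' : Finset I → Set α} (hρ : ∀ y x, 0 ≤ ρ y x) (hδ : 0 ≤ δ) (hC : ∀ y x, |C y x| ≤ a * Real.exp (-(δ * ρ y x)))
    (hZ : ∀ y, ∑ x, Real.exp (-(δ / 2 * ρ y x)) ≤ Z) (hsupp : ∀ b x x', N b x x' ≠ 0 → x ∈ U b ∧ x' ∈ U' b)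
    (hrow : ∀ b x, ∑ x', |N b x x'| ≤ m) (p q : α) (c : Finset (Finset I)) :
    |(C * wker C N c) p q| ≤ a * (a * Z * m) ^ c.card * (c.card.factorial : ℝ) := by
  have ha : 0 ≤ a := by
    by_contra h
    have h' : a * Real.exp (-(δ * ρ p q)) < 0 := mul_neg_of_neg_of_pos (lt_of_not_ge h) (Real.exp_pos _)
    linarith [abs_nonneg (C p q), hC p q]
  have hZ0 : 0 ≤ Z := (sum_nonneg fun _ _ => (Real.exp_pos _).le).trans (hZ p)
  have hg : ∀ y x, Real.exp (-(δ / 2 * ρ y x)) ≤ 1 := fun y x =>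
    Real.exp_le_one_iff.2 (neg_nonpos.2 (mul_nonneg (div_nonneg hδ zero_le_two) (hρ y x)))
  rcases c.eq_empty_or_nonempty with rfl | hc
  · rw [wker_empty, Matrix.mul_one, card_empty, pow_zero, Nat.factorial_zero, Nat.cast_one, mul_one, mul_one]
    exact (hC p q).trans (mul_le_of_le_one_right ha (Real.exp_le_one_iff.2 (neg_nonpos.2 (mul_nonneg hδ (hρ p q)))))
  · obtain ⟨b₀, hb₀⟩ := id hc
    have hm : 0 ≤ m := (sum_nonneg fun _ _ => abs_nonneg _).trans (hrow b₀ p)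
    -- the factorial is a supersolution of the walk recursion with unit gauges
    have hW : ∀ (b : Finset I) (c : Finset (Finset I)), c.Nonempty →
        ∑ b' ∈ c, (1 : ℝ) * ((c.erase b').card.factorial : ℝ) ≤ (c.card.factorial : ℝ) := by
      intro b c hc
      obtain ⟨k, hk⟩ := Nat.exists_eq_add_one_of_ne_zero (card_ne_zero.2 hc)
      have h1 : ∀ b' ∈ c, (1 : ℝ) * ((c.erase b').card.factorial : ℝ) = (k.factorial : ℝ) := fun b' hb' => by
        rw [one_mul, card_erase_of_mem hb', hk, Nat.add_sub_cancel]
      rw [sum_congr rfl h1, sum_const, hk, nsmul_eq_mul, Nat.factorial_succ, Nat.cast_mul]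
    have h := abs_C_mul_wker_apply_le_entry hρ hδ hC hZ hsupp hrow q (E := fun _ _ => (1 : ℝ)) (Eout := fun _ => (1 : ℝ))
      (fun _ _ => zero_le_one) (fun _ _ x' _ x _ => hg x' x) (fun _ x' _ => hg x' q)
      (W := fun _ c => (c.card.factorial : ℝ)) (fun _ _ => Nat.cast_nonneg _) (fun _ => by simp) hW p
      (Ein := fun _ => (1 : ℝ)) (fun _ => zero_le_one) (fun _ x _ => hg p x) hc
    exact h.trans (mul_le_mul_of_nonneg_left (hW b₀ c hc) (by positivity))

/-- **THE DECAY CONTROLS THE SUM OVER WALKS (no factorial).**  If the gauges out of every boundary are uniformly summable —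
`Σ_{b′∈c} E b b′ ≤ K` for all `b` and all `c` (on the lattice: `Σ_{b′} e^{−(δ/2)d(b,b′)} = O(1)` because the boundaries are `r(e_k)` apart) —
and `Eout ≤ 1`, then `W b c = K^{|c|}` is a supersolution of the walk recursion, so on every exit set `|(C𝔫(c))(x′,q)| ≤ a · (aZmK)^{|c|}`:
each boundary costs `aZmK` and the `|c|!` orderings are paid by the decay — the quantitative content of p. 307 *"These control the sum over
walks and partitions, and the factorials, as in [9]"* in its simplest form (all the kept decay given away).
[cite: BalabanImbrieJaffe1988, §5.13 p.307] -/
theorem abs_C_mul_wker_apply_le_geometric {C : Matrix α α ℝ} {N : Finset I → Matrix α α ℝ} {ρ : α → α → ℝ} {a δ Z m K : ℝ}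
    {U U' : Finset I → Set α} (hρ : ∀ y x, 0 ≤ ρ y x) (hδ : 0 ≤ δ) (hC : ∀ y x, |C y x| ≤ a * Real.exp (-(δ * ρ y x)))
    (hZ : ∀ y, ∑ x, Real.exp (-(δ / 2 * ρ y x)) ≤ Z) (hsupp : ∀ b x x', N b x x' ≠ 0 → x ∈ U b ∧ x' ∈ U' b)
    (hrow : ∀ b x, ∑ x', |N b x x'| ≤ m) (q : α) {E : Finset I → Finset I → ℝ} {Eout : Finset I → ℝ}
    (hE0 : ∀ b b', 0 ≤ E b b') (hE : ∀ b b', ∀ x' ∈ U' b, ∀ x ∈ U b', Real.exp (-(δ / 2 * ρ x' x)) ≤ E b b')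
    (hEout : ∀ b, ∀ x' ∈ U' b, Real.exp (-(δ / 2 * ρ x' q)) ≤ Eout b) (hEout1 : ∀ b, Eout b ≤ 1)
    (hK : ∀ (b : Finset I) (c : Finset (Finset I)), ∑ b' ∈ c, E b b' ≤ K) (c : Finset (Finset I)) (b : Finset I) :
    ∀ x' ∈ U' b, |(C * wker C N c) x' q| ≤ a * (a * Z * m * K) ^ c.card := by
  have hK0 : 0 ≤ K := by simpa using hK b ∅
  -- `K^{|c|}` is a supersolution
  have hWs : ∀ (b : Finset I) (c : Finset (Finset I)), c.Nonempty → ∑ b' ∈ c, E b b' * K ^ (c.erase b').card ≤ K ^ c.card := by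
    intro b c hc
    obtain ⟨k, hk⟩ := Nat.exists_eq_add_one_of_ne_zero (card_ne_zero.2 hc)
    have h1 : ∀ b' ∈ c, E b b' * K ^ (c.erase b').card = E b b' * K ^ k := fun b' hb' => by
      rw [card_erase_of_mem hb', hk, Nat.add_sub_cancel]
    rw [sum_congr rfl h1, ← sum_mul, hk, pow_succ, mul_comm (K ^ k) K]
    exact mul_le_mul_of_nonneg_right (hK b c) (pow_nonneg hK0 k)
  intro x' hx'
  have h := abs_C_mul_wker_apply_le hρ hδ hC hZ hsupp hrow q hE0 hE hEout (W := fun _ c => K ^ c.card) (fun _ _ => pow_nonneg hK0 _)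
    (fun b => by simpa using hEout1 b) hWs c b x' hx'
  exact h.trans (le_of_eq (by ring))

/-- … and from any site `p` into `𝔫(c)`, `c ≠ ∅`, if also the entrance gauges are summable (`Σ_{b′∈c} Ein b′ ≤ K`):
`|(C𝔫(c))(p,q)| ≤ a · (aZmK)^{|c|}`. [cite: BalabanImbrieJaffe1988, §5.13 p.307] -/
theorem abs_C_mul_wker_apply_le_geometric_entry {C : Matrix α α ℝ} {N : Finset I → Matrix α α ℝ} {ρ : α → α → ℝ} {a δ Z m K : ℝ}
    {U U' : Finset I → Set α} (hρ : ∀ y x, 0 ≤ ρ y x) (hδ : 0 ≤ δ) (hC : ∀ y x, |C y x| ≤ a * Real.exp (-(δ * ρ y x)))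
    (hZ : ∀ y, ∑ x, Real.exp (-(δ / 2 * ρ y x)) ≤ Z) (hsupp : ∀ b x x', N b x x' ≠ 0 → x ∈ U b ∧ x' ∈ U' b)
    (hrow : ∀ b x, ∑ x', |N b x x'| ≤ m) (q : α) {E : Finset I → Finset I → ℝ} {Eout : Finset I → ℝ}
    (hE0 : ∀ b b', 0 ≤ E b b') (hE : ∀ b b', ∀ x' ∈ U' b, ∀ x ∈ U b', Real.exp (-(δ / 2 * ρ x' x)) ≤ E b b')
    (hEout : ∀ b, ∀ x' ∈ U' b, Real.exp (-(δ / 2 * ρ x' q)) ≤ Eout b) (hEout1 : ∀ b, Eout b ≤ 1)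
    (hK : ∀ (b : Finset I) (c : Finset (Finset I)), ∑ b' ∈ c, E b b' ≤ K) (p : α) {Ein : Finset I → ℝ} (hEin0 : ∀ b', 0 ≤ Ein b')
    (hEin : ∀ b', ∀ x ∈ U b', Real.exp (-(δ / 2 * ρ p x)) ≤ Ein b') {c : Finset (Finset I)} (hc : c.Nonempty)
    (hKin : ∑ b' ∈ c, Ein b' ≤ K) : |(C * wker C N c) p q| ≤ a * (a * Z * m * K) ^ c.card := by
  obtain ⟨b₀, hb₀⟩ := id hc
  have hK0 : 0 ≤ K := by simpa using hK b₀ ∅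
  have ha : 0 ≤ a := by
    by_contra h
    have h' : a * Real.exp (-(δ * ρ p q)) < 0 := mul_neg_of_neg_of_pos (lt_of_not_ge h) (Real.exp_pos _)
    linarith [abs_nonneg (C p q), hC p q]
  have hZ0 : 0 ≤ Z := (sum_nonneg fun _ _ => (Real.exp_pos _).le).trans (hZ p)
  have hm : 0 ≤ m := (sum_nonneg fun _ _ => abs_nonneg _).trans (hrow b₀ p)
  have hWs : ∀ (b : Finset I) (c : Finset (Finset I)), c.Nonempty → ∑ b' ∈ c, E b b' * K ^ (c.erase b').card ≤ K ^ c.card := by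
    intro b c hc
    obtain ⟨k, hk⟩ := Nat.exists_eq_add_one_of_ne_zero (card_ne_zero.2 hc)
    have h1 : ∀ b' ∈ c, E b b' * K ^ (c.erase b').card = E b b' * K ^ k := fun b' hb' => by
      rw [card_erase_of_mem hb', hk, Nat.add_sub_cancel]
    rw [sum_congr rfl h1, ← sum_mul, hk, pow_succ, mul_comm (K ^ k) K]
    exact mul_le_mul_of_nonneg_right (hK b c) (pow_nonneg hK0 k)
  have h := abs_C_mul_wker_apply_le_entry hρ hδ hC hZ hsupp hrow q hE0 hE hEout (W := fun _ c => K ^ c.card)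
    (fun _ _ => pow_nonneg hK0 _) (fun b => by simpa using hEout1 b) hWs p hEin0 hEin hc
  obtain ⟨k, hk⟩ := Nat.exists_eq_add_one_of_ne_zero (card_ne_zero.2 hc)
  have h1 : ∀ b' ∈ c, Ein b' * K ^ (c.erase b').card = Ein b' * K ^ k := fun b' hb' => by
    rw [card_erase_of_mem hb', hk, Nat.add_sub_cancel]
  rw [sum_congr rfl h1, ← sum_mul] at h
  refine h.trans ?_
  rw [hk]
  calc a * (a * Z * m) ^ (k + 1) * ((∑ i ∈ c, Ein i) * K ^ k) ≤ a * (a * Z * m) ^ (k + 1) * (K * K ^ k) :=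
        mul_le_mul_of_nonneg_left (mul_le_mul_of_nonneg_right hKin (pow_nonneg hK0 k)) (by positivity)
    _ = a * (a * Z * m * K) ^ (k + 1) := by ring

end Literature.MathematicalPhysics.QuantumFieldTheory.BalabanImbrieJaffe1984to88.BIJ88WalkKernelDecay307
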